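import Literature.AnabelianGeometry.SemiGraphs.TemperedDecompositionSingleVertex
import Literature.AnabelianGeometry.SemiGraphs.TemperedCuspOmission
import HarnessLib

/-!
# The decomposition subgroups of the STAR `⟨{v}, E⟩` of a vertex (non-loop edges `E` at `v`, far ends open)
# are the verticial subgroups at `v` ([IUTchI] §2 p. 44; [SemiAnbd] Def. 2.1 p. 24, Thm. 3.7 (i)(ii))

Mochizuki, *Inter-universal Teichmüller theory I*, §2 p. 44 l. 28–30 ("the omission of cuspidal edges
clearly does not affect either the tempered or pro-`Σ̂` fundamental groups") and l. 39–44 (decomposition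
groups `Π^tp_ℍ ⊆ Π^tp_𝔾`), Prop. 2.2 p. 45 [cite: Mochizuki2012, IUTchI §2 p.44]; Mochizuki, *Semi-graphs
of anabelioids*, Publ. RIMS **42** (2006), Def. 2.1 p. 24 ("`𝒢_v`" — the sub-semi-graph at a vertex with
the edges abutting to it), §3 Thm. 3.7 (i)/(ii) p. 40 [cite: MochizukiSemiAnbd2006, Thm 3.7(i) p.40].

PROOF-ONLY sequel (abc-iut cell, layer L3, row «DECOMP@STAR», offered 19:46Z as the sequel of
«DECOMP@SINGLE-VERTEX» = GAP row G-w5d028-2 sub-row γ-2; seat abc-iut-L3-t6 gen 7) of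
`TemperedDecompositionSingleVertex.lean`.  There the sub-semi-graph was the EDGELESS single vertex
`⟨{v}, ∅⟩`.  Here `ℍ = ⟨{v}, E⟩` for any set `E` of edges each having EXACTLY ONE branch at `v` (the
edges of the star of `v` that are not loops at `v`; inside `𝒢_ℍ` they are open edges = cusps):

* `isCuspOmission_star` — in `𝒢_{⟨{v}, E⟩}` the omission of all edges, `⟨univ, ∅⟩`, is a cusp omission
  (`SemiGraph.Subgraph.IsCuspOmission`), so abc-iut-L3-t2-lineage's `isEquivalence_btempRestrict`
  ([IUTchI] §2 p. 44: cusp omission does not change `B^temp`) applies, with functor `btempRestrict` ON THE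
  NOSE; composed with `OneVertexEdgeless.chartAt` at the (one-vertex, edgeless) double restriction and
  `TemperedPiChart.transport` this gives a chart of `𝒢_{⟨{v}, E⟩}` with group `Π_v` through which the
  restriction `B^temp(𝒢) → B^temp(𝒢_{⟨{v}, E⟩})` reads `S ↦ S_v` definitionally;
* `verticialSubgroups_subset_decompSubgroups_star`, `decompSubgroups_star_subset_of_nonempty`,
  **`decompSubgroups_star_eq : c.decompSubgroups ⟨{v}, E⟩ = verticialSubgroups c v`** (`𝒢` quasi-coherent
  and Galois-countable) — the same `Iff.rfl` + one-conjugacy-class argument as at `⟨{v}, ∅⟩`;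
* `exists_isVerticialHom_comp_of_isDecompHom_star` — any-chart form;
* **`decompSubgroupsCommensurablyTerminal_star`** — abc-iut-w4-d052's (P2) at stars, by Thm. 3.7 (ii).

Proof-only: 0 definitions (the chart is a term), no instance, no notation, no `Prop` fact; loops at `v`
(both branches at `v`: a closed edge of `𝒢_ℍ`, genuinely changing `Π^tp_ℍ`) are excluded by hypothesis.
Nothing here takes a side on [IUTchIII] Cor. 3.12.
-/

namespace Literature.AnabelianGeometry.SemiGraphs

namespace ProfiniteSemiGraph

open CategoryTheory
open Literature.AnabelianGeometry.AbsoluteAnabelian (IsCommensurablyTerminal)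

universe u

variable {𝒢 : ProfiniteSemiGraph.{u}}

/-! ### The star of a vertex: omitting its (open) edges is a cusp omission -/

/-- **In the star `𝒢_{⟨{v}, E⟩}` the omission of all edges is a cusp omission**, provided every `e ∈ E`
has exactly one branch abutting to `v` (then `e` is an open, non-isolated edge of `𝒢_{⟨{v}, E⟩}`, i.e. a
cusp). [cite: MochizukiSemiAnbd2006, §1 p.13] -/
theorem isCuspOmission_star (v : 𝒢.graph.Vertex) (E : Set 𝒢.graph.Edge)
    (hE : ∀ e ∈ E, ∃ b : 𝒢.graph.Branch, 𝒢.graph.edgeOf b = e ∧ 𝒢.graph.abuts b = some v ∧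
      ∀ b' : 𝒢.graph.Branch, 𝒢.graph.edgeOf b' = e → 𝒢.graph.abuts b' = some v → b' = b) :
    (⟨Set.univ, ∅⟩ : (𝒢.restrict ⟨{v}, E⟩).graph.Subgraph).IsCuspOmission := by
  refine ⟨rfl, fun e _ => ?_⟩
  obtain ⟨b, hbe, hbv, huniq⟩ := hE e.1 e.2
  have hbE : 𝒢.graph.edgeOf b ∈ E := hbe ▸ e.2
  refine ⟨⟨b, hbE⟩, Subtype.ext hbe, ?_, fun b' hb'e hb's => ?_⟩
  · have h : (⟨{v}, E⟩ : 𝒢.graph.Subgraph).toSemiGraph.abuts ⟨b, hbE⟩ = some ⟨v, Set.mem_singleton v⟩ :=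
      (SemiGraph.Subgraph.abuts_mk_eq_some_iff (⟨{v}, E⟩ : 𝒢.graph.Subgraph) hbE
        ⟨v, Set.mem_singleton v⟩).mpr hbv
    change ((⟨{v}, E⟩ : 𝒢.graph.Subgraph).toSemiGraph.abuts ⟨b, hbE⟩).isSome = true
    rw [h]
    rfl
  · obtain ⟨w, hw⟩ := Option.isSome_iff_exists.mp hb's
    have hw' : 𝒢.graph.abuts b'.1 = some w.1 :=
      (SemiGraph.Subgraph.abuts_eq_some_iff (⟨{v}, E⟩ : 𝒢.graph.Subgraph) b' w).mp hw
    have hwv : w.1 = v := w.2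
    rw [hwv] at hw'
    exact Subtype.ext (huniq b'.1 (congrArg Subtype.val hb'e) hw')

namespace TemperedPiChart

/-! ### `decompSubgroups c ⟨{v}, E⟩ = verticialSubgroups c v` -/

/-- **Every verticial subgroup at `v` is a decomposition subgroup of the star `⟨{v}, E⟩`** (non-loop edges
`E` at `v`; `Π_v` second countable): through the chart of `𝒢_{⟨{v}, E⟩}` with group `Π_v` obtained by
transporting `OneVertexEdgeless.chartAt` along the cusp-omission equivalence (`isEquivalence_btempRestrict`),
the restriction `B^temp(𝒢) → B^temp(𝒢_{⟨{v}, E⟩})` reads `S ↦ S_v` definitionally, so a verticial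
homomorphism IS a decomposition homomorphism. [cite: Mochizuki2012, IUTchI §2 p.44] -/
theorem verticialSubgroups_subset_decompSubgroups_star (c : TemperedPiChart 𝒢) (v : 𝒢.graph.Vertex)
    (E : Set 𝒢.graph.Edge)
    (hE : ∀ e ∈ E, ∃ b : 𝒢.graph.Branch, 𝒢.graph.edgeOf b = e ∧ 𝒢.graph.abuts b = some v ∧
      ∀ b' : 𝒢.graph.Branch, 𝒢.graph.edgeOf b' = e → 𝒢.graph.abuts b' = some v → b' = b)
    [SecondCountableTopology (𝒢.Gv v)] :
    verticialSubgroups c v ⊆ c.decompSubgroups ⟨{v}, E⟩ := by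
  rintro H ⟨φ, hφ, rfl⟩
  haveI := isEquivalence_btempRestrict (isCuspOmission_star v E hE)
  haveI : Unique ((𝒢.restrict ⟨{v}, E⟩).restrict ⟨Set.univ, ∅⟩).graph.Vertex :=
    { default := ⟨⟨v, Set.mem_singleton v⟩, Set.mem_univ _⟩
      uniq := fun x => Subtype.ext (Subtype.ext x.1.2) }
  haveI : IsEmpty ((𝒢.restrict ⟨{v}, E⟩).restrict ⟨Set.univ, ∅⟩).graph.Edge := by
    change IsEmpty (↥(∅ : Set (𝒢.restrict ⟨{v}, E⟩).graph.Edge))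
    infer_instance
  haveI : SecondCountableTopology
      (((𝒢.restrict ⟨{v}, E⟩).restrict ⟨Set.univ, ∅⟩).Gv ⟨⟨v, Set.mem_singleton v⟩, Set.mem_univ _⟩) :=
    ‹SecondCountableTopology (𝒢.Gv v)›
  exact ⟨(OneVertexEdgeless.chartAt ((𝒢.restrict ⟨{v}, E⟩).restrict ⟨Set.univ, ∅⟩)
      ⟨⟨v, Set.mem_singleton v⟩, Set.mem_univ _⟩).transport
      ((𝒢.restrict ⟨{v}, E⟩).btempRestrict ⟨Set.univ, ∅⟩).asEquivalence, φ, hφ, rfl⟩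

/-- A decomposition subgroup of the star `⟨{v}, E⟩` is verticial at `v` as soon as some verticial subgroup
at `v` exists (both families are single conjugacy classes). [cite: Mochizuki2012, IUTchI §2 p.44] -/
theorem decompSubgroups_star_subset_of_nonempty (c : TemperedPiChart 𝒢) (v : 𝒢.graph.Vertex)
    (E : Set 𝒢.graph.Edge)
    (hE : ∀ e ∈ E, ∃ b : 𝒢.graph.Branch, 𝒢.graph.edgeOf b = e ∧ 𝒢.graph.abuts b = some v ∧
      ∀ b' : 𝒢.graph.Branch, 𝒢.graph.edgeOf b' = e → 𝒢.graph.abuts b' = some v → b' = b)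
    [SecondCountableTopology (𝒢.Gv v)] (hne : (verticialSubgroups c v).Nonempty) :
    c.decompSubgroups ⟨{v}, E⟩ ⊆ verticialSubgroups c v := by
  intro D hD
  obtain ⟨H₀, hH₀⟩ := hne
  obtain ⟨g, rfl⟩ := exists_conj_of_mem_decompSubgroups
    (verticialSubgroups_subset_decompSubgroups_star c v E hE hH₀) hD
  exact conj_mem_verticialSubgroups c hH₀ g

/-- **`Π^tp_{𝒢_v} = π̂₁(G_v)` for the star of `v`: the decomposition subgroups of `⟨{v}, E⟩` (non-loop
edges `E` at `v`) ARE the verticial subgroups at `v`**, for `𝒢` quasi-coherent and Galois-countable.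
[cite: Mochizuki2012, IUTchI §2 p.44] -/
theorem decompSubgroups_star_eq (hqc : 𝒢.IsQuasiCoherent) (hgc : 𝒢.IsGaloisCountable)
    (c : TemperedPiChart 𝒢) (v : 𝒢.graph.Vertex) (E : Set 𝒢.graph.Edge)
    (hE : ∀ e ∈ E, ∃ b : 𝒢.graph.Branch, 𝒢.graph.edgeOf b = e ∧ 𝒢.graph.abuts b = some v ∧
      ∀ b' : 𝒢.graph.Branch, 𝒢.graph.edgeOf b' = e → 𝒢.graph.abuts b' = some v → b' = b) :
    c.decompSubgroups ⟨{v}, E⟩ = verticialSubgroups c v := by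
  haveI : SecondCountableTopology (𝒢.Gv v) := secondCountableTopology_Gv hqc hgc v
  exact Set.Subset.antisymm
    (decompSubgroups_star_subset_of_nonempty c v E hE (verticialSubgroups_nonempty hqc hgc c v))
    (verticialSubgroups_subset_decompSubgroups_star c v E hE)

/-- The same under the hypotheses of [SemiAnbd] Prop. 3.6. [cite: Mochizuki2012, IUTchI §2 p.44] -/
theorem decompSubgroups_star_eq_of_prop36 (h36 : 𝒢.Prop36Hypotheses) (c : TemperedPiChart 𝒢)
    (v : 𝒢.graph.Vertex) (E : Set 𝒢.graph.Edge)
    (hE : ∀ e ∈ E, ∃ b : 𝒢.graph.Branch, 𝒢.graph.edgeOf b = e ∧ 𝒢.graph.abuts b = some v ∧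
      ∀ b' : 𝒢.graph.Branch, 𝒢.graph.edgeOf b' = e → 𝒢.graph.abuts b' = some v → b' = b) :
    c.decompSubgroups ⟨{v}, E⟩ = verticialSubgroups c v :=
  decompSubgroups_star_eq h36.isQuasiCoherent h36.isGaloisCountable c v E hE

/-- The decomposition subgroups of a star do not depend on which non-loop edges at `v` are kept.
[cite: Mochizuki2012, IUTchI §2 p.44] -/
theorem decompSubgroups_star_eq_singleVertex (hqc : 𝒢.IsQuasiCoherent) (hgc : 𝒢.IsGaloisCountable)
    (c : TemperedPiChart 𝒢) (v : 𝒢.graph.Vertex) (E : Set 𝒢.graph.Edge)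
    (hE : ∀ e ∈ E, ∃ b : 𝒢.graph.Branch, 𝒢.graph.edgeOf b = e ∧ 𝒢.graph.abuts b = some v ∧
      ∀ b' : 𝒢.graph.Branch, 𝒢.graph.edgeOf b' = e → 𝒢.graph.abuts b' = some v → b' = b) :
    c.decompSubgroups ⟨{v}, E⟩ = c.decompSubgroups ⟨{v}, ∅⟩ := by
  rw [decompSubgroups_star_eq hqc hgc c v E hE, decompSubgroups_singleVertex_eq hqc hgc c v]

/-- **Any-chart form**: for EVERY chart `c'` of `𝒢_{⟨{v}, E⟩}`, a decomposition homomorphism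
`φ' : c'.G → π₁^temp(𝒢)` of the star becomes a verticial homomorphism at `v` after composition with a
compatible isomorphism `χ : Π_v ⥲ c'.G` (`ω` its inverse). [cite: MochizukiSemiAnbd2006, Prop 3.6(ii) p.38] -/
theorem exists_isVerticialHom_comp_of_isDecompHom_star (c : TemperedPiChart 𝒢) (v : 𝒢.graph.Vertex)
    (E : Set 𝒢.graph.Edge)
    (hE : ∀ e ∈ E, ∃ b : 𝒢.graph.Branch, 𝒢.graph.edgeOf b = e ∧ 𝒢.graph.abuts b = some v ∧
      ∀ b' : 𝒢.graph.Branch, 𝒢.graph.edgeOf b' = e → 𝒢.graph.abuts b' = some v → b' = b)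
    [SecondCountableTopology (𝒢.Gv v)] (c' : TemperedPiChart (𝒢.restrict ⟨{v}, E⟩))
    {φ' : c'.G →ₜ* c.G} (h : c.IsDecompHom ⟨{v}, E⟩ c' φ') :
    ∃ (χ : 𝒢.Gv v →ₜ* c'.G) (ω : c'.G →ₜ* 𝒢.Gv v), (∀ x, ω (χ x) = x) ∧ (∀ y, χ (ω y) = y) ∧
      IsVerticialHom c v (φ'.comp χ) := by
  haveI := isEquivalence_btempRestrict (isCuspOmission_star v E hE)
  haveI : Unique ((𝒢.restrict ⟨{v}, E⟩).restrict ⟨Set.univ, ∅⟩).graph.Vertex :=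
    { default := ⟨⟨v, Set.mem_singleton v⟩, Set.mem_univ _⟩
      uniq := fun x => Subtype.ext (Subtype.ext x.1.2) }
  haveI : IsEmpty ((𝒢.restrict ⟨{v}, E⟩).restrict ⟨Set.univ, ∅⟩).graph.Edge := by
    change IsEmpty (↥(∅ : Set (𝒢.restrict ⟨{v}, E⟩).graph.Edge))
    infer_instance
  haveI : SecondCountableTopology
      (((𝒢.restrict ⟨{v}, E⟩).restrict ⟨Set.univ, ∅⟩).Gv ⟨⟨v, Set.mem_singleton v⟩, Set.mem_univ _⟩) :=
    ‹SecondCountableTopology (𝒢.Gv v)›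
  obtain ⟨χ, ω, hωχ, hχω, hχ, -⟩ := TemperedPiChart.exists_compatIso
    ((OneVertexEdgeless.chartAt ((𝒢.restrict ⟨{v}, E⟩).restrict ⟨Set.univ, ∅⟩)
      ⟨⟨v, Set.mem_singleton v⟩, Set.mem_univ _⟩).transport
      ((𝒢.restrict ⟨{v}, E⟩).btempRestrict ⟨Set.univ, ∅⟩).asEquivalence) c'
  exact ⟨χ, ω, hωχ, hχω, h.comp_compat χ hχ⟩

/-! ### (P2) at stars -/

/-- **abc-iut-w4-d052's named target (P2) `DecompSubgroupsCommensurablyTerminal` HOLDS at every star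
`⟨{v}, E⟩`** (non-loop edges at `v`) of a `𝒢` as in [SemiAnbd] Thm. 3.7: these decomposition subgroups are
the verticial subgroups at `v`, commensurably terminal by Thm. 3.7 (ii)
(`commensurator_eq_of_mem_verticialSubgroups`). [cite: Mochizuki2012, IUTchI Prop 2.2 p.45] -/
theorem decompSubgroupsCommensurablyTerminal_star (h37 : 𝒢.Thm37Hypotheses) (c : TemperedPiChart 𝒢)
    (v : 𝒢.graph.Vertex) (E : Set 𝒢.graph.Edge)
    (hE : ∀ e ∈ E, ∃ b : 𝒢.graph.Branch, 𝒢.graph.edgeOf b = e ∧ 𝒢.graph.abuts b = some v ∧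
      ∀ b' : 𝒢.graph.Branch, 𝒢.graph.edgeOf b' = e → 𝒢.graph.abuts b' = some v → b' = b) :
    c.DecompSubgroupsCommensurablyTerminal ⟨{v}, E⟩ := by
  intro D hD
  rw [decompSubgroups_star_eq h37.isQuasiCoherent h37.isGaloisCountable c v E hE] at hD
  exact ⟨commensurator_eq_of_mem_verticialSubgroups h37 c hD⟩

end TemperedPiChart

end ProfiniteSemiGraph

end Literature.AnabelianGeometry.SemiGraphs
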